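import Mathlib.MeasureTheory.Integral.Bochner.Basic
import Mathlib.MeasureTheory.Integral.Bochner.L1
import Mathlib.Probability.Moments.Basic
import HarnessLib

/-!
# crux-ideate 1/2 on stmt-QuantumFields-18916 → live crux stmt-QuantumFields-19936 `HistoryTailL` — gen-6 sketch (SORRY-FREE)

Seat `ym-cruxidea-18916-1` (planner, ideator 1 of 2), gen 6, 2026-08-27.  Typed part of the crux idea card
**`sd-stein-kernel-domination`** (Schwinger–Dyson ∕ Stein-kernel Gaussian domination for the level-`j` averaged flux).

The analytic engine of the card is an IDENTITY, not an inequality: on the configuration space `SU(2)^E` with Gibbs law `dμ = Z⁻¹e^{S} dHaar`,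
for every vector field `J` on links one has `E_μ[−(J·∇S + div J)·G] = E_μ[J·∇G]` (integration by parts for Haar; no convexity), hence for
the «SD image» `X := −(J·∇S + div J)` the MOMENT RECURSION `E[X^{2n+2}] = (2n+1)·E[X^{2n}·V]`, `V := J·∇X` (abelian Wilson case: `X = β(φ, sin F)`,
`V = βΣ_p φ_p² cos F_p ≤ β‖φ‖²` pointwise — Gross 1983 Thm 2.5.I).  Gaussian-type moment growth follows from an
UPPER bound `V ≤ v` — which on a compact group needs only UPPER Hessian bounds of `S` (free), in contrast with the Brascamp–Lieb ∕ Bakry–Émery lines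
(cards 6, B-vi) that need LOWER bounds and die at height `K/2`.  The upper bound is needed only on a GOOD event (bare-regular configurations); the
complement enters polynomially and is killed by the superexponential bare tail.  This file kernel-checks exactly that bookkeeping:

* `sd_truncated_moment_bound` — recursion + (`V ≤ v` on `G`) + crude sup bounds `|X| ≤ B`, `|V| ≤ M` ⇒
  `E[X^{2n}] ≤ (2n−1)‼ · (vⁿ + n·M·max(B²,v)^{n−1}·μ(Gᶜ))` for all `n ≤ n₀`.
  With `μ(Gᶜ) ≤ L^{3K}e^{−cP²}` (one-plaquette Wilson tail at amplitude `P ≪ 1/g_K`, the landed chessboard estimate) and `B, M` polynomial in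
  `β_K L^{3K}`, the second term is negligible for all `n ≤ n₀` as soon as `cP² ≳ n₀·log(B²/v)`, i.e. `P ≍ p_j√(K log L)` for the `n₀ ≍ p_j²/(2q)`
  moments that Markov needs for the tail `e^{−p_j²/(2q)}` at threshold `g_j p_j`; since `p_j = b₀(1 + log g_j⁻¹)^{p₀}` with `p₀ > 2`, any fixed
  rate is summable over blocks and heights, so only the SCALE `g_j` and `K`-uniformity matter.

The SD identity itself (Haar integration by parts on a product of compact Lie groups) and the Stein-kernel construction are NOT typed here — they are
the card's kill-tests K2/K3; the toy census G6-S1 (kit j272574, j272714) is the evidence that a gauge-orthogonal least-squares kernel represents the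
abelianised flux up to a Bianchi-invisible residual.
-/

open MeasureTheory

namespace Summit.QuantumFields.YangMills.Cruxes.HistoryTail.SteinKernelG6

/-- `oddDF n = (2n−1)‼` as a real number (`oddDF 0 = 1`), defined by the recursion the SD identity produces. -/
def oddDF : ℕ → ℝ
  | 0 => 1
  | n + 1 => (2 * n + 1) * oddDF n

lemma oddDF_pos : ∀ n, 0 < oddDF n
  | 0 => by simp [oddDF]
  | n + 1 => by
      have := oddDF_pos n
      simp only [oddDF]; positivity

lemma one_le_oddDF : ∀ n, 1 ≤ oddDF n
  | 0 => by simp [oddDF]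
  | n + 1 => by
      have h := one_le_oddDF n
      have hn : (1 : ℝ) ≤ 2 * n + 1 := by
        have : (0:ℝ) ≤ n := Nat.cast_nonneg n
        linarith
      simp only [oddDF]
      nlinarith

/-- Pointwise truncation: on the good set use `V ≤ v`, off it use the crude sup bounds. -/
lemma pow_mul_le_trunc {Ω : Type*} {X V : Ω → ℝ} {B M v : ℝ} (hB : ∀ ω, |X ω| ≤ B) (hM : ∀ ω, |V ω| ≤ M) (hv : 0 ≤ v)
    {G : Set Ω} (hgood : ∀ ω ∈ G, V ω ≤ v) (k : ℕ) (ω : Ω) :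
    X ω ^ (2 * k) * V ω ≤ v * X ω ^ (2 * k) + M * B ^ (2 * k) * Gᶜ.indicator (1 : Ω → ℝ) ω := by
  have hx : 0 ≤ X ω ^ (2 * k) := (even_two_mul k).pow_nonneg _
  have hMnn : 0 ≤ M := le_trans (abs_nonneg _) (hM ω)
  have hBnn : 0 ≤ B := le_trans (abs_nonneg _) (hB ω)
  by_cases hω : ω ∈ G
  · have hind : Gᶜ.indicator (1 : Ω → ℝ) ω = 0 := by
      simp [Set.indicator_of_notMem, hω]
    rw [hind, mul_zero, add_zero]
    calc X ω ^ (2 * k) * V ω ≤ X ω ^ (2 * k) * v := mul_le_mul_of_nonneg_left (hgood ω hω) hx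
      _ = v * X ω ^ (2 * k) := by ring
  · have hind : Gᶜ.indicator (1 : Ω → ℝ) ω = 1 := by
      simp [Set.indicator_of_mem, hω]
    rw [hind, mul_one]
    have h1 : X ω ^ (2 * k) * V ω ≤ B ^ (2 * k) * M := by
      calc X ω ^ (2 * k) * V ω ≤ |X ω ^ (2 * k) * V ω| := le_abs_self _
        _ = |X ω| ^ (2 * k) * |V ω| := by rw [abs_mul, abs_pow]
        _ ≤ B ^ (2 * k) * M := by
            apply mul_le_mul (pow_le_pow_left₀ (abs_nonneg _) (hB ω) _) (hM ω) (abs_nonneg _)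
            positivity
    have h2 : 0 ≤ v * X ω ^ (2 * k) := mul_nonneg hv hx
    linarith

variable {Ω : Type*} [MeasurableSpace Ω]

/-- **SD moment domination with truncation.**  If the even moments of `X` satisfy the Schwinger–Dyson recursion
`E[X^{2n+2}] = (2n+1) E[X^{2n} V]` up to order `n₀`, `V ≤ v` on a good event `G`, and `|X| ≤ B`, `|V| ≤ M` everywhere, then
`E[X^{2n}] ≤ (2n−1)‼ (vⁿ + n M max(B²,v)^{n−1} μ(Gᶜ))` for every `n ≤ n₀`. -/
theorem sd_truncated_moment_bound (μ : Measure Ω) [IsProbabilityMeasure μ] {X V : Ω → ℝ}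
    (hX : Measurable X) (hV : Measurable V) {B M v : ℝ} (hM0 : 0 ≤ M)
    (hB : ∀ ω, |X ω| ≤ B) (hM : ∀ ω, |V ω| ≤ M) (hv : 0 ≤ v)
    {G : Set Ω} (hG : MeasurableSet G) (hgood : ∀ ω ∈ G, V ω ≤ v) {n₀ : ℕ}
    (hrec : ∀ n, n + 1 ≤ n₀ →
      ∫ ω, X ω ^ (2 * n + 2) ∂μ = (2 * n + 1) * ∫ ω, X ω ^ (2 * n) * V ω ∂μ) :
    ∀ n, n ≤ n₀ →
      ∫ ω, X ω ^ (2 * n) ∂μ ≤ oddDF n * (v ^ n + n * M * (max (B ^ 2) v) ^ (n - 1) * (μ Gᶜ).toReal) := by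
  set W := max (B ^ 2) v with hW
  have hvW : v ≤ W := le_max_right _ _
  have hBW : B ^ 2 ≤ W := le_max_left _ _
  have hW0 : 0 ≤ W := le_trans (sq_nonneg B) hBW
  have hμ : 0 ≤ (μ Gᶜ).toReal := ENNReal.toReal_nonneg
  -- integrability of the bounded measurable integrands
  have hintP : ∀ k, Integrable (fun ω => X ω ^ (2 * k)) μ := by
    intro k
    refine Integrable.mono' (integrable_const (B ^ (2 * k))) (hX.pow_const _).aestronglyMeasurable
      (ae_of_all _ ?_)
    intro ω
    rw [Real.norm_eq_abs, abs_pow]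
    exact pow_le_pow_left₀ (abs_nonneg _) (hB ω) _
  have hintPV : ∀ k, Integrable (fun ω => X ω ^ (2 * k) * V ω) μ := by
    intro k
    refine Integrable.mono' (integrable_const (B ^ (2 * k) * M)) ((hX.pow_const _).mul hV).aestronglyMeasurable
      (ae_of_all _ ?_)
    intro ω
    rw [Real.norm_eq_abs, abs_mul, abs_pow]
    exact mul_le_mul (pow_le_pow_left₀ (abs_nonneg _) (hB ω) _) (hM ω) (abs_nonneg _)
      ((even_two_mul k).pow_nonneg B)
  have hintI : Integrable (Gᶜ.indicator (1 : Ω → ℝ)) μ :=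
    (integrable_const (1 : ℝ)).indicator hG.compl
  -- one truncated step:  E[X^{2k} V] ≤ v E[X^{2k}] + M B^{2k} μ(Gᶜ)
  have hstep : ∀ k, ∫ ω, X ω ^ (2 * k) * V ω ∂μ
      ≤ v * ∫ ω, X ω ^ (2 * k) ∂μ + M * B ^ (2 * k) * (μ Gᶜ).toReal := by
    intro k
    have h1 : ∫ ω, X ω ^ (2 * k) * V ω ∂μ
        ≤ ∫ ω, (v * X ω ^ (2 * k) + M * B ^ (2 * k) * Gᶜ.indicator (1 : Ω → ℝ) ω) ∂μ :=
      integral_mono (hintPV k) (((hintP k).const_mul v).add (hintI.const_mul _))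
        (fun ω => pow_mul_le_trunc hB hM hv hgood k ω)
    have h2 : ∫ ω, (v * X ω ^ (2 * k) + M * B ^ (2 * k) * Gᶜ.indicator (1 : Ω → ℝ) ω) ∂μ
        = v * ∫ ω, X ω ^ (2 * k) ∂μ + M * B ^ (2 * k) * (μ Gᶜ).toReal := by
      rw [integral_add ((hintP k).const_mul v) (hintI.const_mul _), integral_const_mul, integral_const_mul,
        integral_indicator_one hG.compl]
      rfl
    linarith
  intro n
  induction n with
  | zero =>
      intro _
      simp [oddDF]
  | succ n ih =>
      intro hn
      have ihn := ih (Nat.le_of_succ_le hn)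
      have hr := hrec n hn
      have hfun : (fun ω => X ω ^ (2 * (n + 1))) = fun ω => X ω ^ (2 * n + 2) := by
        funext ω; ring_nf
      rw [hfun, hr]
      simp only [oddDF, Nat.add_sub_cancel, Nat.cast_succ]
      have h2n1 : (0:ℝ) ≤ 2 * (n:ℝ) + 1 := by positivity
      have hk := hstep n
      -- arithmetic of the induction step
      have p1 : v * ((n:ℝ) * M * W ^ (n - 1)) ≤ (n:ℝ) * M * W ^ n := by
        cases n with
        | zero => simp
        | succ m =>
          simp only [Nat.add_sub_cancel, Nat.cast_succ]
          have hvm : v * W ^ m ≤ W ^ (m + 1) := by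
            rw [pow_succ, mul_comm]
            exact mul_le_mul_of_nonneg_left hvW (pow_nonneg hW0 m)
          have hc : 0 ≤ ((m:ℝ) + 1) * M := by positivity
          calc v * (((m:ℝ) + 1) * M * W ^ m) = (((m:ℝ) + 1) * M) * (v * W ^ m) := by ring
            _ ≤ (((m:ℝ) + 1) * M) * W ^ (m + 1) := mul_le_mul_of_nonneg_left hvm hc
            _ = ((m:ℝ) + 1) * M * W ^ (m + 1) := by ring
      have p2 : M * B ^ (2 * n) * (μ Gᶜ).toReal ≤ oddDF n * (M * W ^ n * (μ Gᶜ).toReal) := by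
        have hb : B ^ (2 * n) ≤ W ^ n := by
          rw [pow_mul]; exact pow_le_pow_left₀ (sq_nonneg B) hBW n
        have h3 : M * B ^ (2 * n) * (μ Gᶜ).toReal ≤ M * W ^ n * (μ Gᶜ).toReal :=
          mul_le_mul_of_nonneg_right (mul_le_mul_of_nonneg_left hb hM0) hμ
        calc _ ≤ M * W ^ n * (μ Gᶜ).toReal := h3
          _ = 1 * (M * W ^ n * (μ Gᶜ).toReal) := by ring
          _ ≤ oddDF n * (M * W ^ n * (μ Gᶜ).toReal) :=
              mul_le_mul_of_nonneg_right (one_le_oddDF n) (by positivity)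
      have hA : v * (oddDF n * (v ^ n + (n:ℝ) * M * W ^ (n - 1) * (μ Gᶜ).toReal))
            + M * B ^ (2 * n) * (μ Gᶜ).toReal
          ≤ oddDF n * (v ^ (n + 1) + ((n:ℝ) + 1) * M * W ^ n * (μ Gᶜ).toReal) := by
        have hodd := oddDF_pos n
        have e1 : v * (oddDF n * (v ^ n + (n:ℝ) * M * W ^ (n - 1) * (μ Gᶜ).toReal))
            = oddDF n * v ^ (n + 1) + oddDF n * (v * ((n:ℝ) * M * W ^ (n - 1))) * (μ Gᶜ).toReal := by ring
        rw [e1]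
        have p1' : oddDF n * (v * ((n:ℝ) * M * W ^ (n - 1))) * (μ Gᶜ).toReal
            ≤ oddDF n * ((n:ℝ) * M * W ^ n) * (μ Gᶜ).toReal :=
          mul_le_mul_of_nonneg_right (mul_le_mul_of_nonneg_left p1 hodd.le) hμ
        nlinarith [p1', p2]
      calc (2 * (n:ℝ) + 1) * ∫ ω, X ω ^ (2 * n) * V ω ∂μ
          ≤ (2 * (n:ℝ) + 1) * (v * ∫ ω, X ω ^ (2 * n) ∂μ + M * B ^ (2 * n) * (μ Gᶜ).toReal) :=
            mul_le_mul_of_nonneg_left hk h2n1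
        _ ≤ (2 * (n:ℝ) + 1) * (v * (oddDF n * (v ^ n + (n:ℝ) * M * W ^ (n - 1) * (μ Gᶜ).toReal))
              + M * B ^ (2 * n) * (μ Gᶜ).toReal) := by
            apply mul_le_mul_of_nonneg_left _ h2n1
            have := mul_le_mul_of_nonneg_left ihn hv
            linarith
        _ ≤ (2 * (n:ℝ) + 1) * (oddDF n * (v ^ (n + 1) + ((n:ℝ) + 1) * M * W ^ n * (μ Gᶜ).toReal)) :=
            mul_le_mul_of_nonneg_left hA h2n1
        _ = (2 * (n:ℝ) + 1) * oddDF n * (v ^ (n + 1) + ((n:ℝ) + 1) * M * W ^ n * (μ Gᶜ).toReal) := by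
            ring

/-- The interface an SD ∕ Stein-kernel ENGINE has to deliver for a real observable `Y` (e.g. the abelianised level-`j` flux through `∂□`):
a representation `Y = X + R` with `X` obeying the SD moment recursion for some proxy `V`, the proxy dominated by `v` on a good event, crude
polynomial sup bounds, and a small remainder `R`.  The card's conjecture is that the Wilson measure at `β_K = γ⁻¹L^K` admits this with
`v = (1+δ) q_j g_j²·E(v̄)`-normalised free variance at EVERY height `j ≤ K(1 − 1/m)` (no RG), the good event being bare `ε₀`-regularity. -/
def SDDominated (μ : Measure Ω) (Y : Ω → ℝ) (v δ B M : ℝ) (G : Set Ω) (n₀ : ℕ) : Prop :=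
  ∃ X V R : Ω → ℝ, Measurable X ∧ Measurable V ∧ (∀ ω, Y ω = X ω + R ω) ∧
    (∀ ω, |X ω| ≤ B) ∧ (∀ ω, |V ω| ≤ M) ∧ (∀ ω ∈ G, V ω ≤ v) ∧ (∀ ω ∈ G, |R ω| ≤ δ) ∧
    (∀ n, n + 1 ≤ n₀ → ∫ ω, X ω ^ (2 * n + 2) ∂μ = (2 * n + 1) * ∫ ω, X ω ^ (2 * n) * V ω ∂μ)

/-- Consumer of the interface: the dominated even moments of the SD part (the remainder `R` and the Markov step are left to the user). -/
theorem SDDominated.moment_bound {μ : Measure Ω} [IsProbabilityMeasure μ] {Y : Ω → ℝ} {v δ B M : ℝ} {G : Set Ω} {n₀ : ℕ}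
    (h : SDDominated μ Y v δ B M G n₀) (hM0 : 0 ≤ M) (hv : 0 ≤ v) (hG : MeasurableSet G) :
    ∃ X R : Ω → ℝ, (∀ ω, Y ω = X ω + R ω) ∧ (∀ ω ∈ G, |R ω| ≤ δ) ∧
      ∀ n, n ≤ n₀ → ∫ ω, X ω ^ (2 * n) ∂μ ≤ oddDF n * (v ^ n + n * M * (max (B ^ 2) v) ^ (n - 1) * (μ Gᶜ).toReal) := by
  obtain ⟨X, V, R, hX, hV, hrep, hB, hM, hgood, hR, hrec⟩ := h
  exact ⟨X, R, hrep, hR, sd_truncated_moment_bound μ hX hV hM0 hB hM hv hG hgood hrec⟩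

end Summit.QuantumFields.YangMills.Cruxes.HistoryTail.SteinKernelG6
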